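import Literature.AlgebraicGeometry.ShimuraVarieties.UnitaryShimuraCurveEmbeddingInjective
import Literature.Topology.Algebra.CompactCosetDepth
import HarnessLib

/-!
# Injectivity of the sub-ball embedding `Sh_{K⋆}(U(J⋆), 𝔻)(ℂ) → Sh_K(U(H), 𝔹²)(ℂ)` at DEEP levels — case (B) of [Del71] Prop. 1.15
# for `U(W^⊥) ↪ U(V)` by FINITENESS AND DEPTH (road (ii) leaf R2-1-inj, file (F-INJ) part 2, §§6–8)

Topic `AlgebraicGeometry/ShimuraVarieties`, namespace `…UnitaryCanonicalModel` (continuation of (F-INJ) part 1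
`UnitaryShimuraCurveEmbeddingInjective`: the coincidence witness, the spine `ShimuraSetGS.embPoints_injective_of_witnesses`, and §5
«a rational element adelically in `im φGS` stabilises `B(L² ⊕ 0)`»).  THEOREMS ONLY (no definition, no instance, no named fact, no
`sorry`; books 0).  Cell `hodgecm-mathlib` (D-0151), road (ii) leaf R2-1-inj (census `A-provers/A-p15/g7/CENSUS-R2-1-inj.A-p15g7.md`,
A-plan2 dossier A.15 ADD.10).  HC_CM is proved only modulo the 7 printed citations until rung 0 closes; nothing here is in a registered cone.

[Deligne1971TravauxShimura] Prop. 1.15 (p. 132) proves injectivity of `_{K¹}M_ℂ(G¹,h¹) → _{K²}M_ℂ(G²,h²)` «pour `K²` assez petit» by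
Noetherian stationarity of the coincidence graph.  Here, on `ℂ`-points and for `G¹ = Res U(J⋆) ↪ G² = Res U(H)`, the same conclusion
is reached ELEMENTARILY: a coincidence witness `γ ∈ U(H)(L⁺)` that does NOT stabilise `W^⊥ = B(L² ⊕ 0)` (a CM self-intersection of the
immersed special curve) is, after re-choosing representatives of the two classes (finitely many cusps-free components (S1), compact
fundamental sets (S2)), one of FINITELY many rational elements (S3, proper discontinuity), each of which is excluded from
`A·K(𝔫)·C` for `𝔫` deep by the compactness lemma ★ `CompactCosetDepth` (A-p09) because the limit set `A·C ⊆ im φGS` contains no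
bad element (part 1 §5).

* §6 `forall_witness_mapsTo_frame_eventually` — case (B) at depth from an abstract FINITE REDUCTION `hred` (★ `CompactCosetDepth.
  exists_forall_ge_forall_not_mem_mul_coe_mul_of_finite` + part 1 §5).
* §7 `exists_finite_reduction` — the reduction `hred` from (S1) representatives, (S2) fundamental sets, (S3) finiteness of witnesses
  between fundamental sets (all three HYPOTHESES here; suppliers: ★ `finite_shimuraIndex`, the cocompactness leaf (S2), A-p09's (S3) leaf
  over ★ `UnitaryBallDiscontinuity.finite_setOf_smul_mem`), with the normalisation algebra `γ′ = embRational(ρ₁)·γ·embRational(ρ₂)⁻¹`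
  (`mapsTo_frame_of_embRational_mul_mul`: badness is invariant).
* §8 `ShimuraSetGS.embPoints_injective_eventually` — the assembly with the spine: given moreover the case (A) closer `hcaseA` ((F-A)
  `UnitaryGroupFrameStabiliser`, A-p02), `embPoints` is injective at every level `Klev i`, `i ≥ i₁`, for every `K⋆` with the trace
  condition.

References: [Deligne1971TravauxShimura] Prop. 1.15 + proof pp. 132–133; [Milne2005ShimuraVarieties] §5 (5.1) p. 56, Lemma 5.13 p. 57,
Thm. 5.16; [BourbakiGT1] Ch. III §4 no. 1 Cor. 1; [Kudla1984] §1; [Liu2021] Thm. 4.15 proof (FJcycle.tex l. 2193–2208).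
-/

noncomputable section

open Function MulAction Matrix NumberField IsDedekindDomain
open scoped Matrix ComplexOrder Pointwise
open Literature.Geometry.ComplexHyperbolic Literature.Geometry.ComplexHyperbolic.BallModel
open Literature.NumberTheory.Automorphic Literature.NumberTheory.Automorphic.UnitaryGroup

namespace Literature.AlgebraicGeometry.ShimuraVarieties

namespace UnitaryCanonicalModel

variable {L : Type} [Field L] [NumberField L] [IsCMField L] {H : Matrix (Fin 3) (Fin 3) L} {τ : L →+* ℂ} {T : GL (Fin 3) ℂ}

section Witness

variable (L H τ T) (hT : formCongr (starRingEnd ℂ) T (H.map τ) = BallModel.J)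
  (Jstar : Matrix (Fin 2) (Fin 2) L) (Jperp : Matrix (Fin 1) (Fin 1) L) (B : GL (Fin 3) L) {a : L} (ha : a ≠ 0)
  (hB : formCongr ((IsCMField.complexConj L : L ≃ₐ[↥(maximalRealSubfield L)] L) : L →+* L) B (a • H) =
    finSum 2 1 Jstar Jperp)
  (hτa : 0 < (τ a).re) (hτa' : (τ a).im = 0)
  (Kstar : Subgroup ↥(finAdelic (↥(maximalRealSubfield L)) L (IsCMField.complexConj L) 2 Jstar))
  (K : Subgroup ↥(finAdelic (↥(maximalRealSubfield L)) L (IsCMField.complexConj L) 3 H))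
  (hK : Kstar.map (φGS L Jstar Jperp H B ha hB) ≤ K)

/-! ### §6. Case (B) at DEPTH from a finite reduction: the assembly over ★ `CompactCosetDepth` -/

/-- **Case (B) eventually, from a FINITE REDUCTION** (census §2 (B0)–(B3)).  Let `K i` be an antitone family of closed levels
of `U(H)(𝔸_f)` shrinking to `1` (e.g. the `B`-adapted principal congruence levels), `A, C ⊆ U(H)(𝔸_f)` compact with
`A·C ⊆ im φGS`, and `E ⊆ U(H)(L⁺)` a FINITE set of «bad» rational elements (not mapping `B(L² ⊕ 0)` into itself) such that
every bad coincidence witness at level `K i` REDUCES to an element of `E` inside `A·K i·C` (hypothesis `hred`: the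
translation of both points into compact fundamental sets + ★ `finite_setOf_smul_mem`, §7).  Then from some index on no
coincidence witness is bad: every witness maps `B(L² ⊕ 0)` into itself — the hypothesis `hcaseB` of the spine
`ShimuraSetGS.embPoints_injective_of_witnesses`.  Proof: each `e ∈ E` has `e_f ∉ A·C` (§5), so ★
`exists_forall_ge_forall_not_mem_mul_coe_mul_of_finite` gives a depth beyond which `e_f ∉ A·K j·C` for all `e ∈ E`,
contradicting `hred`. [cite: Deligne1971TravauxShimura, Prop. 1.15 proof pp. 132–133 («injectif pour K² assez petit»)]
[cite: BourbakiGT1, Ch. III §4 no. 1, Cor. 1] -/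
theorem forall_witness_mapsTo_frame_eventually {ι : Type*} [Preorder ι] [Nonempty ι] [IsDirectedOrder ι]
    (Klev : ι → Subgroup ↥(finAdelic (↥(maximalRealSubfield L)) L (IsCMField.complexConj L) 3 H))
    (hKc : ∀ i, IsClosed (Klev i : Set ↥(finAdelic (↥(maximalRealSubfield L)) L (IsCMField.complexConj L) 3 H)))
    (hKa : Antitone Klev)
    (hK1 : ∀ g : ↥(finAdelic (↥(maximalRealSubfield L)) L (IsCMField.complexConj L) 3 H), (∀ i, g ∈ Klev i) → g = 1)
    {A C : Set ↥(finAdelic (↥(maximalRealSubfield L)) L (IsCMField.complexConj L) 3 H)} (hA : IsCompact A) (hC : IsCompact C)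
    (hAC : A * C ⊆ Set.range (φGS L Jstar Jperp H B ha hB))
    {E : Set (rational (↥(maximalRealSubfield L)) L (IsCMField.complexConj L) 3 H)} (hE : E.Finite)
    (hEbad : ∀ e ∈ E, ∃ x : Fin 2 → L, ∀ y : Fin 2 → L,
      ((e : GL (Fin 3) L) : Matrix (Fin 3) (Fin 3) L) *ᵥ ((B : Matrix (Fin 3) (Fin 3) L) *ᵥ Fin.append x (0 : Fin 1 → L)) ≠
        (B : Matrix (Fin 3) (Fin 3) L) *ᵥ Fin.append y (0 : Fin 1 → L))
    (i₀ : ι)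
    (hred : ∀ i, i₀ ≤ i → ∀ (γ : rational (↥(maximalRealSubfield L)) L (IsCMField.complexConj L) 3 H) (v v' : Fin 2 → ℂ),
      v ∈ negCone (Jstar.map τ) → v' ∈ negCone (Jstar.map τ) →
      ∀ u u' : ↥(finAdelic (↥(maximalRealSubfield L)) L (IsCMField.complexConj L) 2 Jstar),
      (∃ c : ℂ, c ≠ 0 ∧ frameEmbNeg τ B v =
          c • (((Matrix.GeneralLinearGroup.map τ (γ : GL (Fin 3) L) : GL (Fin 3) ℂ) : Matrix (Fin 3) (Fin 3) ℂ) *ᵥ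
            frameEmbNeg τ B v')) →
      ((φGS L Jstar Jperp H B ha hB u)⁻¹ *
            (rationalToFinAdelic (↥(maximalRealSubfield L)) L (IsCMField.complexConj L) 3 H γ * φGS L Jstar Jperp H B ha hB u') :
          ↥(finAdelic (↥(maximalRealSubfield L)) L (IsCMField.complexConj L) 3 H)) ∈ Klev i →
      (∃ x : Fin 2 → L, ∀ y : Fin 2 → L,
        ((γ : GL (Fin 3) L) : Matrix (Fin 3) (Fin 3) L) *ᵥ ((B : Matrix (Fin 3) (Fin 3) L) *ᵥ Fin.append x (0 : Fin 1 → L)) ≠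
          (B : Matrix (Fin 3) (Fin 3) L) *ᵥ Fin.append y (0 : Fin 1 → L)) →
      ∃ e ∈ E, (rationalToFinAdelic (↥(maximalRealSubfield L)) L (IsCMField.complexConj L) 3 H e :
          ↥(finAdelic (↥(maximalRealSubfield L)) L (IsCMField.complexConj L) 3 H)) ∈
          A * (Klev i : Set ↥(finAdelic (↥(maximalRealSubfield L)) L (IsCMField.complexConj L) 3 H)) * C) :
    ∃ i₁, ∀ i, i₁ ≤ i → ∀ (γ : rational (↥(maximalRealSubfield L)) L (IsCMField.complexConj L) 3 H) (v v' : Fin 2 → ℂ),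
      v ∈ negCone (Jstar.map τ) → v' ∈ negCone (Jstar.map τ) →
      ∀ u u' : ↥(finAdelic (↥(maximalRealSubfield L)) L (IsCMField.complexConj L) 2 Jstar),
      (∃ c : ℂ, c ≠ 0 ∧ frameEmbNeg τ B v =
          c • (((Matrix.GeneralLinearGroup.map τ (γ : GL (Fin 3) L) : GL (Fin 3) ℂ) : Matrix (Fin 3) (Fin 3) ℂ) *ᵥ
            frameEmbNeg τ B v')) →
      ((φGS L Jstar Jperp H B ha hB u)⁻¹ *
            (rationalToFinAdelic (↥(maximalRealSubfield L)) L (IsCMField.complexConj L) 3 H γ * φGS L Jstar Jperp H B ha hB u') :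
          ↥(finAdelic (↥(maximalRealSubfield L)) L (IsCMField.complexConj L) 3 H)) ∈ Klev i →
      ∀ x : Fin 2 → L, ∃ y : Fin 2 → L,
        ((γ : GL (Fin 3) L) : Matrix (Fin 3) (Fin 3) L) *ᵥ ((B : Matrix (Fin 3) (Fin 3) L) *ᵥ Fin.append x (0 : Fin 1 → L)) =
          (B : Matrix (Fin 3) (Fin 3) L) *ᵥ Fin.append y (0 : Fin 1 → L) := by
  -- the finite set of bad elements read in `U(H)(𝔸_f)` misses `A·C ⊆ im φGS` (§5)
  set E𝔸 : Set ↥(finAdelic (↥(maximalRealSubfield L)) L (IsCMField.complexConj L) 3 H) :=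
    (fun e => (rationalToFinAdelic (↥(maximalRealSubfield L)) L (IsCMField.complexConj L) 3 H e :
      ↥(finAdelic (↥(maximalRealSubfield L)) L (IsCMField.complexConj L) 3 H))) '' E with hE𝔸
  have hE𝔸fin : E𝔸.Finite := hE.image _
  have hE𝔸AC : ∀ g ∈ E𝔸, g ∉ A * C := by
    rintro _ ⟨e, heE, rfl⟩ hmem
    obtain ⟨x, hx⟩ := hEbad e heE
    obtain ⟨y, hy⟩ := mapsTo_frame_of_rationalToFinAdelic_mem_range L H Jstar Jperp B ha hB e (hAC hmem) x
    exact hx y hy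
  obtain ⟨i₂, hi₂⟩ := Literature.Topology.Algebra.exists_forall_ge_forall_not_mem_mul_coe_mul_of_finite hA hC Klev hKc hKa
    hK1 hE𝔸fin hE𝔸AC
  obtain ⟨i₁, h₀₁, h₂₁⟩ := exists_ge_ge i₀ i₂
  refine ⟨i₁, fun i hi γ v v' hv hv' u u' hball hcoset => ?_⟩
  by_contra hbad
  simp only [not_forall, not_exists] at hbad
  obtain ⟨x, hx⟩ := hbad
  obtain ⟨e, heE, he⟩ := hred i (h₀₁.trans hi) γ v v' hv hv' u u' hball hcoset ⟨x, hx⟩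
  exact hi₂ i (h₂₁.trans hi) _ ⟨e, heE, rfl⟩ he

/-! ### §7. The finite reduction `hred` from representatives (S1), fundamental sets (S2) and discontinuity (S3) -/

/-- `embRational ρ = B(ρ ⊕ᶠ 1)B⁻¹` acts on `B(x ⊕ 0)` as `B(ρx ⊕ 0)` (★ `conj_finSum_one_right_mulVec_frameEmb_zero` over `L`).
[cite: Kudla1984, §1] [cite: Liu2021, Thm. 4.15 proof (FJcycle.tex l. 2193–2203)] -/
theorem embRational_mulVec_frame (ρ : ↥(rational (↥(maximalRealSubfield L)) L (IsCMField.complexConj L) 2 Jstar)) (x : Fin 2 → L) :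
    (((embRational (↥(maximalRealSubfield L)) L (IsCMField.complexConj L) 2 1 Jstar Jperp H B ha hB ρ :
        rational (↥(maximalRealSubfield L)) L (IsCMField.complexConj L) 3 H) : GL (Fin 3) L) : Matrix (Fin 3) (Fin 3) L) *ᵥ
        ((B : Matrix (Fin 3) (Fin 3) L) *ᵥ Fin.append x (0 : Fin 1 → L)) =
      (B : Matrix (Fin 3) (Fin 3) L) *ᵥ Fin.append (((ρ : ↥(rational (↥(maximalRealSubfield L)) L (IsCMField.complexConj L) 2 Jstar)) :
        GL (Fin 2) L) *ᵥ x) (0 : Fin 1 → L) := by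
  have h1 : (((rationalBlockDiag (↥(maximalRealSubfield L)) L (IsCMField.complexConj L) 2 1 Jstar Jperp (ρ, 1) :
      rational (↥(maximalRealSubfield L)) L (IsCMField.complexConj L) (2 + 1) (finSum 2 1 Jstar Jperp)) : GL (Fin (2 + 1)) L) :
        Matrix (Fin (2 + 1)) (Fin (2 + 1)) L) =
      finSum 2 1 (((ρ : ↥(rational (↥(maximalRealSubfield L)) L (IsCMField.complexConj L) 2 Jstar)) : GL (Fin 2) L) :
        Matrix (Fin 2) (Fin 2) L) 1 := by
    rw [coe_rationalBlockDiag, coe_reindexGL]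
    change Matrix.reindex finSumFinEquiv finSumFinEquiv (Matrix.fromBlocks _ 0 0
      (((1 : rational (↥(maximalRealSubfield L)) L (IsCMField.complexConj L) 1 Jperp) : GL (Fin 1) L) : Matrix (Fin 1) (Fin 1) L)) = _
    rw [OneMemClass.coe_one, Units.val_one]
    rfl
  rw [coe_embRational, Units.val_mul, Units.val_mul, h1]
  exact conj_finSum_one_right_mulVec_frameEmb_zero (N₁ := 2) (N₂ := 1) (show GL (Fin (2 + 1)) L from B) _ x

/-- `embRational ρ` maps `B(L² ⊕ 0)` into itself. [cite: Kudla1984, §1] -/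
theorem mapsTo_frame_embRational (ρ : ↥(rational (↥(maximalRealSubfield L)) L (IsCMField.complexConj L) 2 Jstar)) (x : Fin 2 → L) :
    ∃ y : Fin 2 → L,
      (((embRational (↥(maximalRealSubfield L)) L (IsCMField.complexConj L) 2 1 Jstar Jperp H B ha hB ρ :
          rational (↥(maximalRealSubfield L)) L (IsCMField.complexConj L) 3 H) : GL (Fin 3) L) : Matrix (Fin 3) (Fin 3) L) *ᵥ
          ((B : Matrix (Fin 3) (Fin 3) L) *ᵥ Fin.append x (0 : Fin 1 → L)) =
        (B : Matrix (Fin 3) (Fin 3) L) *ᵥ Fin.append y (0 : Fin 1 → L) :=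
  ⟨_, embRational_mulVec_frame L H Jstar Jperp B ha hB ρ x⟩

/-- Elements mapping `B(L² ⊕ 0)` into itself are closed under products. [folklore] -/
private theorem mapsTo_frame_mul {γ₁ γ₂ : rational (↥(maximalRealSubfield L)) L (IsCMField.complexConj L) 3 H}
    (h₁ : ∀ x : Fin 2 → L, ∃ y : Fin 2 → L,
      ((γ₁ : GL (Fin 3) L) : Matrix (Fin 3) (Fin 3) L) *ᵥ ((B : Matrix (Fin 3) (Fin 3) L) *ᵥ Fin.append x (0 : Fin 1 → L)) =
        (B : Matrix (Fin 3) (Fin 3) L) *ᵥ Fin.append y (0 : Fin 1 → L))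
    (h₂ : ∀ x : Fin 2 → L, ∃ y : Fin 2 → L,
      ((γ₂ : GL (Fin 3) L) : Matrix (Fin 3) (Fin 3) L) *ᵥ ((B : Matrix (Fin 3) (Fin 3) L) *ᵥ Fin.append x (0 : Fin 1 → L)) =
        (B : Matrix (Fin 3) (Fin 3) L) *ᵥ Fin.append y (0 : Fin 1 → L)) (x : Fin 2 → L) :
    ∃ y : Fin 2 → L,
      (((γ₁ * γ₂ : rational (↥(maximalRealSubfield L)) L (IsCMField.complexConj L) 3 H) : GL (Fin 3) L) : Matrix (Fin 3) (Fin 3) L) *ᵥ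
          ((B : Matrix (Fin 3) (Fin 3) L) *ᵥ Fin.append x (0 : Fin 1 → L)) =
        (B : Matrix (Fin 3) (Fin 3) L) *ᵥ Fin.append y (0 : Fin 1 → L) := by
  obtain ⟨y₂, hy₂⟩ := h₂ x
  obtain ⟨y₁, hy₁⟩ := h₁ y₂
  refine ⟨y₁, ?_⟩
  rw [Subgroup.coe_mul, Units.val_mul, ← mulVec_mulVec, hy₂, hy₁]

/-- **Badness is invariant under the two-sided action of `im embRational`**: if `e₁ γ e₂` maps `B(L² ⊕ 0)` into itself, so does
`γ` (for `e₁ = embRational ρ₁`, `e₂ = embRational ρ₂`). [cite: Deligne1971TravauxShimura, Prop. 1.15 proof p. 132] -/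
theorem mapsTo_frame_of_embRational_mul_mul (ρ₁ ρ₂ : ↥(rational (↥(maximalRealSubfield L)) L (IsCMField.complexConj L) 2 Jstar))
    (γ : rational (↥(maximalRealSubfield L)) L (IsCMField.complexConj L) 3 H)
    (h : ∀ x : Fin 2 → L, ∃ y : Fin 2 → L,
      (((embRational (↥(maximalRealSubfield L)) L (IsCMField.complexConj L) 2 1 Jstar Jperp H B ha hB ρ₁ * γ *
          embRational (↥(maximalRealSubfield L)) L (IsCMField.complexConj L) 2 1 Jstar Jperp H B ha hB ρ₂ :
          rational (↥(maximalRealSubfield L)) L (IsCMField.complexConj L) 3 H) : GL (Fin 3) L) : Matrix (Fin 3) (Fin 3) L) *ᵥ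
          ((B : Matrix (Fin 3) (Fin 3) L) *ᵥ Fin.append x (0 : Fin 1 → L)) =
        (B : Matrix (Fin 3) (Fin 3) L) *ᵥ Fin.append y (0 : Fin 1 → L)) (x : Fin 2 → L) :
    ∃ y : Fin 2 → L,
      ((γ : GL (Fin 3) L) : Matrix (Fin 3) (Fin 3) L) *ᵥ ((B : Matrix (Fin 3) (Fin 3) L) *ᵥ Fin.append x (0 : Fin 1 → L)) =
        (B : Matrix (Fin 3) (Fin 3) L) *ᵥ Fin.append y (0 : Fin 1 → L) := by
  set e₁ := embRational (↥(maximalRealSubfield L)) L (IsCMField.complexConj L) 2 1 Jstar Jperp H B ha hB ρ₁ with he₁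
  set e₂ := embRational (↥(maximalRealSubfield L)) L (IsCMField.complexConj L) 2 1 Jstar Jperp H B ha hB ρ₂ with he₂
  have hγ : γ = e₁⁻¹ * (e₁ * γ * e₂) * e₂⁻¹ := by group
  rw [hγ]
  have h₁ := mapsTo_frame_embRational L H Jstar Jperp B ha hB ρ₁⁻¹
  have h₂ := mapsTo_frame_embRational L H Jstar Jperp B ha hB ρ₂⁻¹
  rw [map_inv] at h₁ h₂
  exact mapsTo_frame_mul L H B (mapsTo_frame_mul L H B h₁ h) h₂ x

/-- **The FINITE REDUCTION `hred`** (census §2 (B0)–(B2)) from: (S1) finitely many representatives `s` of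
`U(J⋆)(L⁺)∖U(J⋆)(𝔸_f)/K⋆₀`; (S2) for each representative `g ∈ s` a COMPACT fundamental set `F g` of the cone for
`Γ⋆(K⋆₀; g)` modulo `ℂˣ`; (S3) FINITENESS of the rational witnesses in `φ(g)·Klev i₀·φ(g′)⁻¹` carrying `ι(F g′)` to meet
`ℂˣ·ι(F g)`.  Output: a finite set `E` of BAD rational elements and compact `A, C ⊆ im φGS·(reps)` with `A·C ⊆ im φGS` such
that every bad coincidence witness at any level `Klev i ≤ Klev i₀` reduces (re-choosing representatives of the two classes:
`u = γ⋆⁻¹ g k`, then moving the cone vectors into `F g` by `Γ⋆(K⋆₀;g)`, and conjugating the witness by the corresponding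
`embRational`s — badness is invariant, `mapsTo_frame_of_embRational_mul_mul`) to an element of `E` inside `A·Klev i·C` —
the hypothesis `hred` of §6. [cite: Deligne1971TravauxShimura, Prop. 1.15 proof pp. 132–133]
[cite: Milne2005ShimuraVarieties, Lemma 5.13 p. 57] -/
theorem exists_finite_reduction {ι : Type*} [Preorder ι]
    (Klev : ι → Subgroup ↥(finAdelic (↥(maximalRealSubfield L)) L (IsCMField.complexConj L) 3 H)) (hKa : Antitone Klev) (i₀ : ι)
    (Kstar₀ : Subgroup ↥(finAdelic (↥(maximalRealSubfield L)) L (IsCMField.complexConj L) 2 Jstar))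
    (hKstar₀c : IsCompact (Kstar₀ : Set ↥(finAdelic (↥(maximalRealSubfield L)) L (IsCMField.complexConj L) 2 Jstar)))
    (hKstar₀ : Kstar₀.map (φGS L Jstar Jperp H B ha hB) ≤ Klev i₀)
    (s : Finset ↥(finAdelic (↥(maximalRealSubfield L)) L (IsCMField.complexConj L) 2 Jstar))
    (hs : ∀ u : ↥(finAdelic (↥(maximalRealSubfield L)) L (IsCMField.complexConj L) 2 Jstar),
      ∃ γs : ↥(rational (↥(maximalRealSubfield L)) L (IsCMField.complexConj L) 2 Jstar), ∃ g ∈ s,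
        g⁻¹ * (rationalToFinAdelic (↥(maximalRealSubfield L)) L (IsCMField.complexConj L) 2 Jstar γs * u) ∈ Kstar₀)
    (F : ↥(finAdelic (↥(maximalRealSubfield L)) L (IsCMField.complexConj L) 2 Jstar) → Set (Fin 2 → ℂ))
    (hFfund : ∀ g ∈ s, ∀ v ∈ negCone (Jstar.map τ),
      ∃ δ : ↥(rational (↥(maximalRealSubfield L)) L (IsCMField.complexConj L) 2 Jstar),
        g⁻¹ * (rationalToFinAdelic (↥(maximalRealSubfield L)) L (IsCMField.complexConj L) 2 Jstar δ * g) ∈ Kstar₀ ∧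
        ∃ c : ℂ, c ≠ 0 ∧ c • (((ratToGLℂ L Jstar τ δ : GL (Fin 2) ℂ) : Matrix (Fin 2) (Fin 2) ℂ) *ᵥ v) ∈ F g)
    (hS3 : ∀ g ∈ s, ∀ g' ∈ s,
      {γ : rational (↥(maximalRealSubfield L)) L (IsCMField.complexConj L) 3 H |
        ((φGS L Jstar Jperp H B ha hB g)⁻¹ *
            (rationalToFinAdelic (↥(maximalRealSubfield L)) L (IsCMField.complexConj L) 3 H γ * φGS L Jstar Jperp H B ha hB g') :
          ↥(finAdelic (↥(maximalRealSubfield L)) L (IsCMField.complexConj L) 3 H)) ∈ Klev i₀ ∧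
        ∃ f ∈ F g, ∃ f' ∈ F g', ∃ c : ℂ, c ≠ 0 ∧ frameEmbNeg τ B f =
          c • (((Matrix.GeneralLinearGroup.map τ (γ : GL (Fin 3) L) : GL (Fin 3) ℂ) : Matrix (Fin 3) (Fin 3) ℂ) *ᵥ
            frameEmbNeg τ B f')}.Finite) :
    ∃ (E : Set (rational (↥(maximalRealSubfield L)) L (IsCMField.complexConj L) 3 H))
      (A C : Set ↥(finAdelic (↥(maximalRealSubfield L)) L (IsCMField.complexConj L) 3 H)),
      E.Finite ∧ IsCompact A ∧ IsCompact C ∧ A * C ⊆ Set.range (φGS L Jstar Jperp H B ha hB) ∧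
      (∀ e ∈ E, ∃ x : Fin 2 → L, ∀ y : Fin 2 → L,
        ((e : GL (Fin 3) L) : Matrix (Fin 3) (Fin 3) L) *ᵥ ((B : Matrix (Fin 3) (Fin 3) L) *ᵥ Fin.append x (0 : Fin 1 → L)) ≠
          (B : Matrix (Fin 3) (Fin 3) L) *ᵥ Fin.append y (0 : Fin 1 → L)) ∧
      ∀ i, i₀ ≤ i → ∀ (γ : rational (↥(maximalRealSubfield L)) L (IsCMField.complexConj L) 3 H) (v v' : Fin 2 → ℂ),
        v ∈ negCone (Jstar.map τ) → v' ∈ negCone (Jstar.map τ) →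
        ∀ u u' : ↥(finAdelic (↥(maximalRealSubfield L)) L (IsCMField.complexConj L) 2 Jstar),
        (∃ c : ℂ, c ≠ 0 ∧ frameEmbNeg τ B v =
            c • (((Matrix.GeneralLinearGroup.map τ (γ : GL (Fin 3) L) : GL (Fin 3) ℂ) : Matrix (Fin 3) (Fin 3) ℂ) *ᵥ
              frameEmbNeg τ B v')) →
        ((φGS L Jstar Jperp H B ha hB u)⁻¹ *
              (rationalToFinAdelic (↥(maximalRealSubfield L)) L (IsCMField.complexConj L) 3 H γ * φGS L Jstar Jperp H B ha hB u') :
            ↥(finAdelic (↥(maximalRealSubfield L)) L (IsCMField.complexConj L) 3 H)) ∈ Klev i →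
        (∃ x : Fin 2 → L, ∀ y : Fin 2 → L,
          ((γ : GL (Fin 3) L) : Matrix (Fin 3) (Fin 3) L) *ᵥ ((B : Matrix (Fin 3) (Fin 3) L) *ᵥ Fin.append x (0 : Fin 1 → L)) ≠
            (B : Matrix (Fin 3) (Fin 3) L) *ᵥ Fin.append y (0 : Fin 1 → L)) →
        ∃ e ∈ E, (rationalToFinAdelic (↥(maximalRealSubfield L)) L (IsCMField.complexConj L) 3 H e :
            ↥(finAdelic (↥(maximalRealSubfield L)) L (IsCMField.complexConj L) 3 H)) ∈
          A * (Klev i : Set ↥(finAdelic (↥(maximalRealSubfield L)) L (IsCMField.complexConj L) 3 H)) * C := by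
  classical
  -- the compact sets `A = ⋃_{g ∈ s} (φGS L Jstar Jperp H B ha hB)(g·K⋆₀)`, `C = ⋃_{g ∈ s} (φGS L Jstar Jperp H B ha hB)(K⋆₀·g⁻¹)`
  let A : Set ↥(finAdelic (↥(maximalRealSubfield L)) L (IsCMField.complexConj L) 3 H) :=
    ⋃ g ∈ s, (fun k => (φGS L Jstar Jperp H B ha hB) (g * k)) '' (Kstar₀ : Set _)
  let C : Set ↥(finAdelic (↥(maximalRealSubfield L)) L (IsCMField.complexConj L) 3 H) :=
    ⋃ g ∈ s, (fun k => (φGS L Jstar Jperp H B ha hB) (k * g⁻¹)) '' (Kstar₀ : Set _)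
  have hAc : IsCompact A := s.finite_toSet.isCompact_biUnion fun g _ =>
    hKstar₀c.image ((continuous_φGS L Jstar Jperp H B ha hB).comp (continuous_const.mul continuous_id))
  have hCc : IsCompact C := s.finite_toSet.isCompact_biUnion fun g _ =>
    hKstar₀c.image ((continuous_φGS L Jstar Jperp H B ha hB).comp (continuous_id.mul continuous_const))
  have hAC : A * C ⊆ Set.range (φGS L Jstar Jperp H B ha hB) := by
    rintro _ ⟨a, ha', c', hc', rfl⟩
    simp only [A, C, Set.mem_iUnion, Set.mem_image] at ha' hc'
    obtain ⟨g, -, k, -, rfl⟩ := ha'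
    obtain ⟨g', -, k', -, rfl⟩ := hc'
    exact ⟨g * k * (k' * g'⁻¹), by rw [map_mul]⟩
  -- the finite set of bad witnesses between fundamental sets
  let E : Set (rational (↥(maximalRealSubfield L)) L (IsCMField.complexConj L) 3 H) :=
    {e | (∃ x : Fin 2 → L, ∀ y : Fin 2 → L,
        ((e : GL (Fin 3) L) : Matrix (Fin 3) (Fin 3) L) *ᵥ ((B : Matrix (Fin 3) (Fin 3) L) *ᵥ Fin.append x (0 : Fin 1 → L)) ≠
          (B : Matrix (Fin 3) (Fin 3) L) *ᵥ Fin.append y (0 : Fin 1 → L)) ∧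
      ∃ g ∈ s, ∃ g' ∈ s, ((φGS L Jstar Jperp H B ha hB) g)⁻¹ * ((rationalToFinAdelic (↥(maximalRealSubfield L)) L (IsCMField.complexConj L) 3 H) e * (φGS L Jstar Jperp H B ha hB) g') ∈ Klev i₀ ∧
        ∃ f ∈ F g, ∃ f' ∈ F g', ∃ c : ℂ, c ≠ 0 ∧ frameEmbNeg τ B f =
          c • (((Matrix.GeneralLinearGroup.map τ (e : GL (Fin 3) L) : GL (Fin 3) ℂ) : Matrix (Fin 3) (Fin 3) ℂ) *ᵥ
            frameEmbNeg τ B f')}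
  have hEfin : E.Finite := by
    refine Set.Finite.subset (Set.Finite.biUnion s.finite_toSet fun g hg =>
      Set.Finite.biUnion s.finite_toSet fun g' hg' => hS3 g hg g' hg') ?_
    intro e he
    obtain ⟨-, g, hg, g', hg', hlev, hmeet⟩ := he
    simp only [Set.mem_iUnion]
    exact ⟨g, hg, g', hg', hlev, hmeet⟩
  refine ⟨E, A, C, hEfin, hAc, hCc, hAC, fun e he => he.1, ?_⟩
  -- the reduction
  intro i hi γ v v' hv hv' u u' hball hcoset hbad
  obtain ⟨c, hc, hballc⟩ := hball
  -- (S1) representatives: `g₁⁻¹ γ⋆₁ u = k₁ ∈ K⋆₀`, `g₂⁻¹ γ⋆₂ u′ = k₂ ∈ K⋆₀`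
  obtain ⟨γs₁, g₁, hg₁, hk₁⟩ := hs u
  obtain ⟨γs₂, g₂, hg₂, hk₂⟩ := hs u'
  -- (S2) fundamental sets for `γ⋆ᵢ vᵢ`
  obtain ⟨δ₁, hδ₁, c₁, hc₁, hf₁⟩ := hFfund g₁ hg₁ _ (ratToGLℂ_mulVec_mem_negCone γs₁ hv)
  obtain ⟨δ₂, hδ₂, c₂, hc₂, hf₂⟩ := hFfund g₂ hg₂ _ (ratToGLℂ_mulVec_mem_negCone γs₂ hv')
  -- the conjugated witness `γ′ = (embRational (↥(maximalRealSubfield L)) L (IsCMField.complexConj L) 2 1 Jstar Jperp H B ha hB)(δ₁γ⋆₁) · γ · (embRational (↥(maximalRealSubfield L)) L (IsCMField.complexConj L) 2 1 Jstar Jperp H B ha hB)(δ₂γ⋆₂)⁻¹`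
  set ρ₁ : ↥(rational (↥(maximalRealSubfield L)) L (IsCMField.complexConj L) 2 Jstar) := δ₁ * γs₁ with hρ₁
  set ρ₂ : ↥(rational (↥(maximalRealSubfield L)) L (IsCMField.complexConj L) 2 Jstar) := δ₂ * γs₂ with hρ₂
  set γ' : rational (↥(maximalRealSubfield L)) L (IsCMField.complexConj L) 3 H := (embRational (↥(maximalRealSubfield L)) L (IsCMField.complexConj L) 2 1 Jstar Jperp H B ha hB) ρ₁ * γ * ((embRational (↥(maximalRealSubfield L)) L (IsCMField.complexConj L) 2 1 Jstar Jperp H B ha hB) ρ₂)⁻¹ with hγ'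
  -- the two fundamental-set points
  set f₁ : Fin 2 → ℂ := c₁ • (((ratToGLℂ L Jstar τ δ₁ : GL (Fin 2) ℂ) : Matrix (Fin 2) (Fin 2) ℂ) *ᵥ
    ((((ratToGLℂ L Jstar τ γs₁ : GL (Fin 2) ℂ) : Matrix (Fin 2) (Fin 2) ℂ) *ᵥ v))) with hf₁def
  set f₂ : Fin 2 → ℂ := c₂ • (((ratToGLℂ L Jstar τ δ₂ : GL (Fin 2) ℂ) : Matrix (Fin 2) (Fin 2) ℂ) *ᵥ
    ((((ratToGLℂ L Jstar τ γs₂ : GL (Fin 2) ℂ) : Matrix (Fin 2) (Fin 2) ℂ) *ᵥ v'))) with hf₂def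
  have hf₁ρ : f₁ = c₁ • (((ratToGLℂ L Jstar τ ρ₁ : GL (Fin 2) ℂ) : Matrix (Fin 2) (Fin 2) ℂ) *ᵥ v) := by
    rw [hf₁def, hρ₁, map_mul, Units.val_mul, ← mulVec_mulVec]
  have hf₂ρ : f₂ = c₂ • (((ratToGLℂ L Jstar τ ρ₂ : GL (Fin 2) ℂ) : Matrix (Fin 2) (Fin 2) ℂ) *ᵥ v') := by
    rw [hf₂def, hρ₂, map_mul, Units.val_mul, ← mulVec_mulVec]
  -- `γ′` is bad (badness is invariant under `im embRational` on both sides)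
  have hbad' : ∃ x : Fin 2 → L, ∀ y : Fin 2 → L,
      ((γ' : GL (Fin 3) L) : Matrix (Fin 3) (Fin 3) L) *ᵥ ((B : Matrix (Fin 3) (Fin 3) L) *ᵥ Fin.append x (0 : Fin 1 → L)) ≠
        (B : Matrix (Fin 3) (Fin 3) L) *ᵥ Fin.append y (0 : Fin 1 → L) := by
    obtain ⟨x, hx⟩ := hbad
    by_contra hgood
    simp only [not_exists, not_forall, not_not] at hgood
    obtain ⟨y, hy⟩ := mapsTo_frame_of_embRational_mul_mul L H Jstar Jperp B ha hB ρ₁ ρ₂⁻¹ γ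
      (fun x' => by rw [map_inv, ← hγ']; exact hgood x') x
    exact hx y hy
  -- group bookkeeping in `U(J⋆)(𝔸_f)`: `ρ₁ u = g₁ (k₁′ k₁)`, `ρ₂ u′ = g₂ (k₂′ k₂)`
  have hu₁ : (rationalToFinAdelic (↥(maximalRealSubfield L)) L (IsCMField.complexConj L) 2 Jstar) ρ₁ * u = g₁ * (g₁⁻¹ * ((rationalToFinAdelic (↥(maximalRealSubfield L)) L (IsCMField.complexConj L) 2 Jstar) δ₁ * g₁) * (g₁⁻¹ * ((rationalToFinAdelic (↥(maximalRealSubfield L)) L (IsCMField.complexConj L) 2 Jstar) γs₁ * u))) := by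
    rw [hρ₁, map_mul]; group
  have hu₂ : (rationalToFinAdelic (↥(maximalRealSubfield L)) L (IsCMField.complexConj L) 2 Jstar) ρ₂ * u' = g₂ * (g₂⁻¹ * ((rationalToFinAdelic (↥(maximalRealSubfield L)) L (IsCMField.complexConj L) 2 Jstar) δ₂ * g₂) * (g₂⁻¹ * ((rationalToFinAdelic (↥(maximalRealSubfield L)) L (IsCMField.complexConj L) 2 Jstar) γs₂ * u'))) := by
    rw [hρ₂, map_mul]; group
  have hK₁ : g₁⁻¹ * ((rationalToFinAdelic (↥(maximalRealSubfield L)) L (IsCMField.complexConj L) 2 Jstar) δ₁ * g₁) * (g₁⁻¹ * ((rationalToFinAdelic (↥(maximalRealSubfield L)) L (IsCMField.complexConj L) 2 Jstar) γs₁ * u)) ∈ Kstar₀ := Kstar₀.mul_mem hδ₁ hk₁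
  have hK₂ : g₂⁻¹ * ((rationalToFinAdelic (↥(maximalRealSubfield L)) L (IsCMField.complexConj L) 2 Jstar) δ₂ * g₂) * (g₂⁻¹ * ((rationalToFinAdelic (↥(maximalRealSubfield L)) L (IsCMField.complexConj L) 2 Jstar) γs₂ * u')) ∈ Kstar₀ := Kstar₀.mul_mem hδ₂ hk₂
  -- the finite-adelic image of `γ′`
  have hrtfγ' : (rationalToFinAdelic (↥(maximalRealSubfield L)) L (IsCMField.complexConj L) 3 H) γ' = (φGS L Jstar Jperp H B ha hB) ((rationalToFinAdelic (↥(maximalRealSubfield L)) L (IsCMField.complexConj L) 2 Jstar) ρ₁ * u) * (((φGS L Jstar Jperp H B ha hB) u)⁻¹ * ((rationalToFinAdelic (↥(maximalRealSubfield L)) L (IsCMField.complexConj L) 3 H) γ * (φGS L Jstar Jperp H B ha hB) u')) * ((φGS L Jstar Jperp H B ha hB) ((rationalToFinAdelic (↥(maximalRealSubfield L)) L (IsCMField.complexConj L) 2 Jstar) ρ₂ * u'))⁻¹ := by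
    rw [hγ', map_mul, map_mul, map_inv, rationalToFinAdelic_embRational_eq_φGS,
      rationalToFinAdelic_embRational_eq_φGS]
    simp only [map_mul]
    group
  have hmemA : (φGS L Jstar Jperp H B ha hB) ((rationalToFinAdelic (↥(maximalRealSubfield L)) L (IsCMField.complexConj L) 2 Jstar) ρ₁ * u) ∈ A := by
    simp only [A, Set.mem_iUnion, Set.mem_image]
    exact ⟨g₁, hg₁, _, hK₁, by rw [hu₁]⟩
  have hmemC : ((φGS L Jstar Jperp H B ha hB) ((rationalToFinAdelic (↥(maximalRealSubfield L)) L (IsCMField.complexConj L) 2 Jstar) ρ₂ * u'))⁻¹ ∈ C := by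
    simp only [C, Set.mem_iUnion, Set.mem_image]
    refine ⟨g₂, hg₂, _, Kstar₀.inv_mem hK₂, ?_⟩
    simp only [hu₂, map_mul, map_inv, _root_.mul_inv_rev, mul_assoc]
  -- the ball relation for `γ′` between the fundamental-set points `f₁`, `f₂`
  have hE₁ : frameEmbNeg τ B f₁ =
      c₁ • (((Matrix.GeneralLinearGroup.map τ (((embRational (↥(maximalRealSubfield L)) L (IsCMField.complexConj L) 2 1 Jstar Jperp H B ha hB) ρ₁ : rational (↥(maximalRealSubfield L)) L (IsCMField.complexConj L) 3 H) :
        GL (Fin 3) L) : GL (Fin 3) ℂ) : Matrix (Fin 3) (Fin 3) ℂ) *ᵥ frameEmbNeg τ B v) := by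
    rw [hf₁ρ, frameEmbNeg_smul', map_embRational_mulVec_frameEmbNeg]
  have hE₂ : frameEmbNeg τ B f₂ =
      c₂ • (((Matrix.GeneralLinearGroup.map τ (((embRational (↥(maximalRealSubfield L)) L (IsCMField.complexConj L) 2 1 Jstar Jperp H B ha hB) ρ₂ : rational (↥(maximalRealSubfield L)) L (IsCMField.complexConj L) 3 H) :
        GL (Fin 3) L) : GL (Fin 3) ℂ) : Matrix (Fin 3) (Fin 3) ℂ) *ᵥ frameEmbNeg τ B v') := by
    rw [hf₂ρ, frameEmbNeg_smul', map_embRational_mulVec_frameEmbNeg]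
  have hcoeγ' : ((Matrix.GeneralLinearGroup.map τ (γ' : GL (Fin 3) L) : GL (Fin 3) ℂ) : Matrix (Fin 3) (Fin 3) ℂ) *
      ((Matrix.GeneralLinearGroup.map τ (((embRational (↥(maximalRealSubfield L)) L (IsCMField.complexConj L) 2 1 Jstar Jperp H B ha hB) ρ₂ :
          rational (↥(maximalRealSubfield L)) L (IsCMField.complexConj L) 3 H) : GL (Fin 3) L) : GL (Fin 3) ℂ) : Matrix (Fin 3) (Fin 3) ℂ) =
      ((Matrix.GeneralLinearGroup.map τ (((embRational (↥(maximalRealSubfield L)) L (IsCMField.complexConj L) 2 1 Jstar Jperp H B ha hB) ρ₁ :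
          rational (↥(maximalRealSubfield L)) L (IsCMField.complexConj L) 3 H) : GL (Fin 3) L) : GL (Fin 3) ℂ) : Matrix (Fin 3) (Fin 3) ℂ) *
        ((Matrix.GeneralLinearGroup.map τ (γ : GL (Fin 3) L) : GL (Fin 3) ℂ) : Matrix (Fin 3) (Fin 3) ℂ) := by
    have hprod : γ' * (embRational (↥(maximalRealSubfield L)) L (IsCMField.complexConj L) 2 1 Jstar Jperp H B ha hB) ρ₂ =
        (embRational (↥(maximalRealSubfield L)) L (IsCMField.complexConj L) 2 1 Jstar Jperp H B ha hB) ρ₁ * γ := by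
      rw [hγ']; group
    have h := congrArg (fun δ : rational (↥(maximalRealSubfield L)) L (IsCMField.complexConj L) 3 H =>
      ((Matrix.GeneralLinearGroup.map τ (δ : GL (Fin 3) L) : GL (Fin 3) ℂ) : Matrix (Fin 3) (Fin 3) ℂ)) hprod
    simp only [Subgroup.coe_mul, map_mul, Units.val_mul] at h
    exact h
  have hball' : frameEmbNeg τ B f₁ =
      (c₁ * c * c₂⁻¹) • (((Matrix.GeneralLinearGroup.map τ (γ' : GL (Fin 3) L) : GL (Fin 3) ℂ) : Matrix (Fin 3) (Fin 3) ℂ) *ᵥ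
        frameEmbNeg τ B f₂) := by
    rw [hE₁, hballc, hE₂, mulVec_smul, mulVec_smul, smul_smul, smul_smul, mulVec_mulVec, mulVec_mulVec, hcoeγ',
      inv_mul_cancel_right₀ hc₂]
  -- conclude
  refine ⟨γ', ⟨hbad', g₁, hg₁, g₂, hg₂, ?_, f₁, hf₁, f₂, hf₂, c₁ * c * c₂⁻¹,
    mul_ne_zero (mul_ne_zero hc₁ hc) (inv_ne_zero hc₂), hball'⟩, ?_⟩
  · -- base-level membership `(φGS L Jstar Jperp H B ha hB)(g₁)⁻¹ γ′_f (φGS L Jstar Jperp H B ha hB)(g₂) = (φGS L Jstar Jperp H B ha hB)(k₁′k₁) · m · (φGS L Jstar Jperp H B ha hB)(k₂′k₂)⁻¹ ∈ Klev i₀`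
    have hm : (((φGS L Jstar Jperp H B ha hB) u)⁻¹ * ((rationalToFinAdelic (↥(maximalRealSubfield L)) L (IsCMField.complexConj L) 3 H) γ * (φGS L Jstar Jperp H B ha hB) u')) ∈ Klev i₀ := hKa hi hcoset
    have h1 : (φGS L Jstar Jperp H B ha hB) (g₁⁻¹ * ((rationalToFinAdelic (↥(maximalRealSubfield L)) L (IsCMField.complexConj L) 2 Jstar) δ₁ * g₁) * (g₁⁻¹ * ((rationalToFinAdelic (↥(maximalRealSubfield L)) L (IsCMField.complexConj L) 2 Jstar) γs₁ * u))) ∈ Klev i₀ := hKstar₀ (Subgroup.mem_map_of_mem _ hK₁)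
    have h2 : (φGS L Jstar Jperp H B ha hB) (g₂⁻¹ * ((rationalToFinAdelic (↥(maximalRealSubfield L)) L (IsCMField.complexConj L) 2 Jstar) δ₂ * g₂) * (g₂⁻¹ * ((rationalToFinAdelic (↥(maximalRealSubfield L)) L (IsCMField.complexConj L) 2 Jstar) γs₂ * u'))) ∈ Klev i₀ := hKstar₀ (Subgroup.mem_map_of_mem _ hK₂)
    have key : ((φGS L Jstar Jperp H B ha hB) g₁)⁻¹ * ((φGS L Jstar Jperp H B ha hB) (g₁ * (g₁⁻¹ * ((rationalToFinAdelic (↥(maximalRealSubfield L)) L (IsCMField.complexConj L) 2 Jstar) δ₁ * g₁) * (g₁⁻¹ * ((rationalToFinAdelic (↥(maximalRealSubfield L)) L (IsCMField.complexConj L) 2 Jstar) γs₁ * u)))) * (((φGS L Jstar Jperp H B ha hB) u)⁻¹ * ((rationalToFinAdelic (↥(maximalRealSubfield L)) L (IsCMField.complexConj L) 3 H) γ * (φGS L Jstar Jperp H B ha hB) u')) * ((φGS L Jstar Jperp H B ha hB) (g₂ * (g₂⁻¹ * ((rationalToFinAdelic (↥(maximalRealSubfield L)) L (IsCMField.complexConj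 L) 2 Jstar) δ₂ * g₂) * (g₂⁻¹ * ((rationalToFinAdelic (↥(maximalRealSubfield L)) L (IsCMField.complexConj L) 2 Jstar) γs₂ * u')))))⁻¹ * (φGS L Jstar Jperp H B ha hB) g₂) =
        (φGS L Jstar Jperp H B ha hB) (g₁⁻¹ * ((rationalToFinAdelic (↥(maximalRealSubfield L)) L (IsCMField.complexConj L) 2 Jstar) δ₁ * g₁) * (g₁⁻¹ * ((rationalToFinAdelic (↥(maximalRealSubfield L)) L (IsCMField.complexConj L) 2 Jstar) γs₁ * u))) * (((φGS L Jstar Jperp H B ha hB) u)⁻¹ * ((rationalToFinAdelic (↥(maximalRealSubfield L)) L (IsCMField.complexConj L) 3 H) γ * (φGS L Jstar Jperp H B ha hB) u')) * ((φGS L Jstar Jperp H B ha hB) (g₂⁻¹ * ((rationalToFinAdelic (↥(maximalRealSubfield L)) L (IsCMField.complexConj L) 2 Jstar) δ₂ * g₂) * (g₂⁻¹ * ((rationalToFinAdelic (↥(maximalRealSubfield L)) L (IsCMField.complexConj L) 2 Jstar) γs₂ * u'))))⁻¹ := by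
      simp only [map_mul]
      group
    rw [hrtfγ', hu₁, hu₂, key]
    exact (Klev i₀).mul_mem ((Klev i₀).mul_mem h1 hm) ((Klev i₀).inv_mem h2)
  · -- `γ′_f ∈ A · Klev i · C`
    rw [hrtfγ']
    exact Set.mul_mem_mul (Set.mul_mem_mul hmemA hcoset) hmemC

/-! ### §8. The assembly: `embPoints` is injective at every deep enough level of a shrinking family -/

/-- **[Del71] Prop. 1.15 for `U(W^⊥) ↪ U(V)`, injectivity half, on `ℂ`-points — EVENTUALLY IN A SHRINKING FAMILY OF LEVELS.**
Let `(Klev i)` be an antitone family of closed levels of `U(H)(𝔸_f)` shrinking to `1` (e.g. the `B`-adapted principal congruence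
levels), `K⋆₀` a compact level of `U(J⋆)(𝔸_f)` with `φGS(K⋆₀) ≤ Klev i₀`, and suppose the three finiteness inputs of §7 ((S1)
finitely many representatives `s` of `U(J⋆)(L⁺)∖U(J⋆)(𝔸_f)/K⋆₀`, (S2) compact fundamental sets `F g` for `Γ⋆(K⋆₀; g)` on the cone
modulo `ℂˣ`, (S3) finiteness of the rational witnesses between fundamental sets at the base level) and the CASE (A) closer `hcaseA`
((F-A) `UnitaryGroupFrameStabiliser`: at every deep level a witness stabilising `B(L² ⊕ 0)` is `embRational γ⋆`).  Then there is a
depth `i₁` beyond which, for EVERY level `K⋆` of the curve with the trace condition `(Klev i).comap φGS ≤ K⋆` and `φGS(K⋆) ≤ Klev i`,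
`ShimuraSetGS.embPoints : Sh_{K⋆}(U(J⋆),𝔻)(ℂ) → Sh_{Klev i}(U(H),𝔹²)(ℂ)` is INJECTIVE — the spine §4 fed by §6/§7 (case (B)) and
`hcaseA`.  «pour `K²` assez petit»: here `K² = Klev i`, `i ≥ i₁`. [cite: Deligne1971TravauxShimura, Prop. 1.15 + proof pp. 132–133]
[cite: Milne2005ShimuraVarieties, Thm. 5.16 and Lemma 5.13 p. 57] -/
theorem ShimuraSetGS.embPoints_injective_eventually {ι : Type*} [Preorder ι] [Nonempty ι] [IsDirectedOrder ι]
    (Klev : ι → Subgroup ↥(finAdelic (↥(maximalRealSubfield L)) L (IsCMField.complexConj L) 3 H))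
    (hKc : ∀ i, IsClosed (Klev i : Set ↥(finAdelic (↥(maximalRealSubfield L)) L (IsCMField.complexConj L) 3 H)))
    (hKa : Antitone Klev) (hK1 : ∀ g : ↥(finAdelic (↥(maximalRealSubfield L)) L (IsCMField.complexConj L) 3 H), (∀ i, g ∈ Klev i) → g = 1) (i₀ : ι)
    (Kstar₀ : Subgroup ↥(finAdelic (↥(maximalRealSubfield L)) L (IsCMField.complexConj L) 2 Jstar)) (hKstar₀c : IsCompact (Kstar₀ : Set ↥(finAdelic (↥(maximalRealSubfield L)) L (IsCMField.complexConj L) 2 Jstar)))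
    (hKstar₀ : Kstar₀.map (φGS L Jstar Jperp H B ha hB) ≤ Klev i₀)
    (s : Finset ↥(finAdelic (↥(maximalRealSubfield L)) L (IsCMField.complexConj L) 2 Jstar))
    (hs : ∀ u : ↥(finAdelic (↥(maximalRealSubfield L)) L (IsCMField.complexConj L) 2 Jstar), ∃ γs : ↥(rational (↥(maximalRealSubfield L)) L (IsCMField.complexConj L) 2 Jstar), ∃ g ∈ s, g⁻¹ * (rationalToFinAdelic (↥(maximalRealSubfield L)) L (IsCMField.complexConj L) 2 Jstar γs * u) ∈ Kstar₀)
    (F : ↥(finAdelic (↥(maximalRealSubfield L)) L (IsCMField.complexConj L) 2 Jstar) → Set (Fin 2 → ℂ))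
    (hFfund : ∀ g ∈ s, ∀ v ∈ negCone (Jstar.map τ), ∃ δ : ↥(rational (↥(maximalRealSubfield L)) L (IsCMField.complexConj L) 2 Jstar),
        g⁻¹ * (rationalToFinAdelic (↥(maximalRealSubfield L)) L (IsCMField.complexConj L) 2 Jstar δ * g) ∈ Kstar₀ ∧
        ∃ c : ℂ, c ≠ 0 ∧ c • (((ratToGLℂ L Jstar τ δ : GL (Fin 2) ℂ) : Matrix (Fin 2) (Fin 2) ℂ) *ᵥ v) ∈ F g)
    (hS3 : ∀ g ∈ s, ∀ g' ∈ s,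
      {γ : rational (↥(maximalRealSubfield L)) L (IsCMField.complexConj L) 3 H |
        ((φGS L Jstar Jperp H B ha hB g)⁻¹ * (rationalToFinAdelic (↥(maximalRealSubfield L)) L (IsCMField.complexConj L) 3 H γ * φGS L Jstar Jperp H B ha hB g') : ↥(finAdelic (↥(maximalRealSubfield L)) L (IsCMField.complexConj L) 3 H)) ∈ Klev i₀ ∧
        ∃ f ∈ F g, ∃ f' ∈ F g', ∃ c : ℂ, c ≠ 0 ∧ frameEmbNeg τ B f =
          c • (((Matrix.GeneralLinearGroup.map τ (γ : GL (Fin 3) L) : GL (Fin 3) ℂ) : Matrix (Fin 3) (Fin 3) ℂ) *ᵥ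
            frameEmbNeg τ B f')}.Finite)
    (hcaseA : ∀ i, i₀ ≤ i → ∀ (γ : rational (↥(maximalRealSubfield L)) L (IsCMField.complexConj L) 3 H) (u u' : ↥(finAdelic (↥(maximalRealSubfield L)) L (IsCMField.complexConj L) 2 Jstar)),
      (∀ x : Fin 2 → L, ∃ y : Fin 2 → L,
        ((γ : GL (Fin 3) L) : Matrix (Fin 3) (Fin 3) L) *ᵥ ((B : Matrix (Fin 3) (Fin 3) L) *ᵥ Fin.append x (0 : Fin 1 → L)) =
          (B : Matrix (Fin 3) (Fin 3) L) *ᵥ Fin.append y (0 : Fin 1 → L)) →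
      ((φGS L Jstar Jperp H B ha hB u)⁻¹ * (rationalToFinAdelic (↥(maximalRealSubfield L)) L (IsCMField.complexConj L) 3 H γ * φGS L Jstar Jperp H B ha hB u') : ↥(finAdelic (↥(maximalRealSubfield L)) L (IsCMField.complexConj L) 3 H)) ∈ Klev i →
      ∃ γs : ↥(rational (↥(maximalRealSubfield L)) L (IsCMField.complexConj L) 2 Jstar), γ = embRational (↥(maximalRealSubfield L)) L (IsCMField.complexConj L) 2 1 Jstar Jperp H B ha hB γs) :
    ∃ i₁, ∀ i, i₁ ≤ i → ∀ (Kstar : Subgroup ↥(finAdelic (↥(maximalRealSubfield L)) L (IsCMField.complexConj L) 2 Jstar)) (hK : Kstar.map (φGS L Jstar Jperp H B ha hB) ≤ Klev i),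
      (Klev i).comap (φGS L Jstar Jperp H B ha hB) ≤ Kstar →
      Function.Injective (ShimuraSetGS.embPoints L H τ T hT Jstar Jperp B ha hB hτa hτa' Kstar (Klev i) hK) := by
  obtain ⟨E, A, C, hE, hA, hC, hAC, hEbad, hred⟩ := exists_finite_reduction L H τ Jstar Jperp B ha hB Klev hKa i₀ Kstar₀ hKstar₀c
    hKstar₀ s hs F hFfund hS3
  obtain ⟨i₂, hi₂⟩ := forall_witness_mapsTo_frame_eventually L H τ Jstar Jperp B ha hB Klev hKc hKa hK1 hA hC hAC hE hEbad i₀ hred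
  obtain ⟨i₁, h₀₁, h₂₁⟩ := exists_ge_ge i₀ i₂
  refine ⟨i₁, fun i hi Kstar hK hKc' => ?_⟩
  exact ShimuraSetGS.embPoints_injective_of_witnesses L H τ T hT Jstar Jperp B ha hB hτa hτa' Kstar (Klev i) hK hKc'
    (hi₂ i (h₂₁.trans hi)) (fun γ u u' hst hco => hcaseA i (h₀₁.trans hi) γ u u' hst hco)

end Witness

end UnitaryCanonicalModel

end Literature.AlgebraicGeometry.ShimuraVarieties

end
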